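import Literature.NumberTheory.EllipticCurves.YanZhu2026.AnticyclotomicBDPOfHeegnerPointAnyClassNumber
import HarnessLib

/-!
# Yan–Zhu 2026 Thm. 5.9, pinned and class-number-free (the named fact
# `thm59_XGr_isTorsion_bdp_of_heegnerPoint_localised_pinned_anyClassNumber` of
# `AnticyclotomicBDPOfHeegnerPointAnyClassNumber.lean`): PROVED unfoldings and bookkeeping

Theorems only (no definition, no named fact, no `sorry`); companion of the statement-only file
`AnticyclotomicBDPOfHeegnerPointAnyClassNumber.lean` (cell `pub/bsd-print-x9`, REF-104 ADDENDUM
"(T2)-general", seat `bsd-line-x10b-p3`).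

* `thm59_anyClassNumber_halves_of_thm59_pinned` — BOOKKEEPING: on its printed special case `p ∤ h_K`
  the class-number-free fact is implied by the accepted pinned typing
  `thm59_XGr_isTorsion_bdp_iff_heegnerPoint_localised_pinned` (two of its four halves, with the binder
  `¬ p ∣ classNumber K` re-inserted) — so the only content of the new fact beyond the accepted one is
  the range `p ∣ h_K` (proof-level flag `YZ59-anyhK@BCK52-How04`), and in direction it is never
  stronger than the source.
* `isTorsion_XAc_of_thm59_pinned_anyClassNumber` — the torsion clause.
* `bdp_mem_of_heegner_le_of_thm59_pinned_anyClassNumber` — the `S = {1}` unfolding: for a family with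
  `p`-adic-unit Manin constant, `(heegnerCharIdeal D F)² ⊆ char(𝒳_tor)` gives `L ∈ char(𝒳_Gr)·R₀⟦T⟧`, at
  every class number; letter for letter the transfer hypothesis `h59gp` of the consumers
  `Summits/BirchSwinnertonDyer/BirchSwinnertonDyer/Theorems/PrintX10bTwoSidedLinkAnyClassNumberX10bOfPrintFactsPinned[Link].lean`.

References: X. Yan, X. Zhu, J. Algebra 693 (2026) = arXiv:2412.20078v4, Thm. 5.9 (l.1283–1293), proof of
Thm. 5.7 (l.1295–1308); A. Burungale, F. Castella, C.-H. Kim, ANT 15 (2021) = arXiv:1908.09512, Remark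
1.2, Thm. 5.2.
-/

noncomputable section

open scoped Classical

open PowerSeries WeierstrassCurve NumberField IsDedekindDomain Field
  Literature.NumberTheory.EllipticCurves Literature.NumberTheory.EllipticCurves.ModularForms
  Literature.NumberTheory.QuadraticFields Literature.NumberTheory.EllipticCurves.Rank1Residual
  Literature.NumberTheory.EllipticCurves.Castella2018

namespace Literature.NumberTheory.EllipticCurves.YanZhu2026

section AnyClassNumberAPI

variable {p : ℕ} [Fact p.Prime] {K : Type} [Field K] [NumberField K]

/-- **Bookkeeping: on its printed special case `p ∤ h_K` the class-number-free fact is TWO HALVES OF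
THE ACCEPTED PINNED TYPING** — `thm59_…_pinned` implies the statement of
`thm59_…_pinned_anyClassNumber` with the binder `¬ p ∣ classNumber K` re-inserted (so the only content
of the new fact beyond the accepted one is the range `p ∣ h_K`, flag `YZ59-anyhK@BCK52-How04`; and
in direction it is never stronger than the source). [cite: YanZhu2024MainConjNonCM, Thm. 5.9 (arXiv:2412.20078v4 TeX l.1283–1293)] -/
theorem thm59_anyClassNumber_halves_of_thm59_pinned
    (h : thm59_XGr_isTorsion_bdp_iff_heegnerPoint_localised_pinned)
    (ι' : PadicAlgCl p ≃+* ℂ) (W : WeierstrassCurve ℚ) [W.IsElliptic] [W.IsGloballyMinimal]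
    (v vbar : HeightOneSpectrum (𝓞 K)) (κ : ZpExtension K p) (γ : absoluteGaloisGroup K)
    [Fact (κ.IsTopGenerator γ)] {N : ℕ} [NeZero N] {f : CuspForm (CongruenceSubgroup.Gamma0 N) 2}
    (jbar : AlgebraicClosure K →+* ℂ) (hf : IsNewformOf W f) (hN : N = W.conductorNorm ℤ)
    (hp : 3 ≤ p) (hord : GoodOrd W p) (hirr : (W.baseChange K).HasIrreducibleModPGaloisRep p)
    (hK : IsImaginaryQuadratic K) (hH : SatisfiesHeegnerHypothesis N K)
    (hsplit : ((Ideal.span {(p : ℤ)}).primesOver (𝓞 K)).ncard = 2) (hodd : Odd (discr K))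
    (hne3 : discr K ≠ -3) (hκ : κ.IsAnticyclotomic) (hhK : ¬ p ∣ classNumber K)
    (hι : ∀ (w : InfinitePlace K) (k : 𝓞 K), k ∈ v.asIdeal ↔ ‖ι'.symm (w.embedding (k : K))‖ < 1)
    (hvbar : ((p : ℕ) : 𝓞 K) ∈ vbar.asIdeal) (hne : vbar ≠ v) :
    ∃ (ΩK : ℂ) (Ωp : (unrIntegers p)ˣ) (L : UnrSeries p),
      ΩK ≠ 0 ∧ IsBDPLFunction ι' v κ γ f ΩK ((Ωp : unrIntegers p) : ℂ_[p]) L ∧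
      Module.IsTorsion (IwasawaAlgebra p) (AcSelmer.XAc (W.baseChange K) p κ vbar ∅ γ) ∧
      ∀ (D : (W.baseChange K).LambdaAdicSelmerData κ γ) (F : HeegnerFamily N W K κ jbar)
        (X : (W.baseChange K).SelmerDualData κ γ) (j : ℤ_[p] →+* unrIntegers p),
        ¬ (p : ℤ) ∣ F.Dt.c →
        (∀ x : ℤ_[p], ((j x : unrIntegers p) : ℂ_[p]) = algebraMap ℚ_[p] ℂ_[p] (x : ℚ_[p])) →
        ∀ s : IwasawaAlgebra p, s ≠ 0 →
          ((∃ n : ℕ, ∀ g ∈ heegnerCharIdeal D F ^ 2,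
              s ^ n * g ∈ Module.charIdeal (IwasawaAlgebra p)
                (Submodule.torsion (IwasawaAlgebra p) X.X)) →
            (∃ n : ℕ, (PowerSeries.map j s) ^ n * L ∈
              (AcSelmer.XAc.charIdeal (W.baseChange K) p κ vbar ∅ γ).map (PowerSeries.map j))) ∧
          ((∃ n : ℕ, ∀ G ∈ (AcSelmer.XAc.charIdeal (W.baseChange K) p κ vbar ∅ γ).map
              (PowerSeries.map j), (PowerSeries.map j s) ^ n * G ∈ Ideal.span {L}) →
            (∃ n : ℕ, ∀ g ∈ Module.charIdeal (IwasawaAlgebra p)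
              (Submodule.torsion (IwasawaAlgebra p) X.X), s ^ n * g ∈ heegnerCharIdeal D F ^ 2)) := by
  have hyp : Thm57Hypotheses N W K p κ γ :=
    { isElliptic := inferInstance, level := hN, three_le := hp, goodOrd := hord, irreducible := hirr,
      isImaginaryQuadratic := hK, heegner := hH, discr_odd := hodd, discr_ne := hne3, split := hsplit,
      not_dvd_classNumber := hhK, anticyclotomic := hκ, topGenerator := Fact.out }
  obtain ⟨ΩK, Ωp, L, hΩK, hL, htor, hiff⟩ := h ι' W K v vbar κ γ jbar hyp hf hι hvbar hne
  exact ⟨ΩK, Ωp, L, hΩK, hL, htor, fun D F X j hc hj s hs ↦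
    ⟨(hiff D F X j hc hj s hs).1.2, (hiff D F X j hc hj s hs).2.1⟩⟩

/-- Theorem 5.9 (pinned, any class number) contains the torsion of `𝒳_{𝓕_Gr}(E/K_∞⁻)` (also part of
Thm. 5.7 (1), class-number-free there too). [cite: YanZhu2024MainConjNonCM, Thm. 5.9, first clause (arXiv:2412.20078v4 TeX l.1284)] -/
theorem isTorsion_XAc_of_thm59_pinned_anyClassNumber
    (h : thm59_XGr_isTorsion_bdp_of_heegnerPoint_localised_pinned_anyClassNumber)
    (ι' : PadicAlgCl p ≃+* ℂ) (W : WeierstrassCurve ℚ) [W.IsElliptic] [W.IsGloballyMinimal]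
    (v vbar : HeightOneSpectrum (𝓞 K)) (κ : ZpExtension K p) (γ : absoluteGaloisGroup K)
    [Fact (κ.IsTopGenerator γ)] {N : ℕ} [NeZero N] {f : CuspForm (CongruenceSubgroup.Gamma0 N) 2}
    (jbar : AlgebraicClosure K →+* ℂ) (hf : IsNewformOf W f) (hN : N = W.conductorNorm ℤ)
    (hp : 3 ≤ p) (hord : GoodOrd W p) (hirr : (W.baseChange K).HasIrreducibleModPGaloisRep p)
    (hK : IsImaginaryQuadratic K) (hH : SatisfiesHeegnerHypothesis N K)
    (hsplit : ((Ideal.span {(p : ℤ)}).primesOver (𝓞 K)).ncard = 2) (hodd : Odd (discr K))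
    (hne3 : discr K ≠ -3) (hκ : κ.IsAnticyclotomic)
    (hι : ∀ (w : InfinitePlace K) (k : 𝓞 K), k ∈ v.asIdeal ↔ ‖ι'.symm (w.embedding (k : K))‖ < 1)
    (hvbar : ((p : ℕ) : 𝓞 K) ∈ vbar.asIdeal) (hne : vbar ≠ v) :
    Module.IsTorsion (IwasawaAlgebra p) (AcSelmer.XAc (W.baseChange K) p κ vbar ∅ γ) := by
  obtain ⟨-, -, -, -, -, htor, -⟩ :=
    h ι' W K v vbar κ γ jbar hf hN hp hord hirr hK hH hsplit hodd hne3 hκ hι hvbar hne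
  exact htor

/-- **Theorem 5.9 (pinned, any class number) at `S = {1}`**: for a Heegner family with `p`-adic-unit
Manin constant, the integral Heegner point divisibility `(heegnerCharIdeal D F)² ⊆ char(𝒳_tor)` gives
the integral BDP divisibility `L ∈ char(𝒳_Gr)·R₀⟦T⟧`, at EVERY class number — the step "The reverse
divisibility is established by combining Theorem 5.8 and Theorem 5.9" of the proof of Thm. 5.7
(l.1300), integrally, for print's class; letter for letter the transfer hypothesis `h59gp` of the
cell's kernel re-runs (`Summits/…/PrintX10bTwoSidedLinkAnyClassNumberX10bOfPrintFactsPinned.lean`).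
[cite: YanZhu2024MainConjNonCM, proof of Thm. 5.7 (arXiv:2412.20078v4 TeX l.1295–1308)]
[cite: BurungaleCastellaKim2021, Remark 1.2 and Thm. 5.2 (arXiv:1908.09512v2 TeX l.192–195, l.1044–1097)] -/
theorem bdp_mem_of_heegner_le_of_thm59_pinned_anyClassNumber
    (h : thm59_XGr_isTorsion_bdp_of_heegnerPoint_localised_pinned_anyClassNumber)
    (ι' : PadicAlgCl p ≃+* ℂ) (W : WeierstrassCurve ℚ) [W.IsElliptic] [W.IsGloballyMinimal]
    (v vbar : HeightOneSpectrum (𝓞 K)) (κ : ZpExtension K p) (γ : absoluteGaloisGroup K)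
    [Fact (κ.IsTopGenerator γ)] {N : ℕ} [NeZero N] {f : CuspForm (CongruenceSubgroup.Gamma0 N) 2}
    (jbar : AlgebraicClosure K →+* ℂ) (hf : IsNewformOf W f) (hN : N = W.conductorNorm ℤ)
    (hp : 3 ≤ p) (hord : GoodOrd W p) (hirr : (W.baseChange K).HasIrreducibleModPGaloisRep p)
    (hK : IsImaginaryQuadratic K) (hH : SatisfiesHeegnerHypothesis N K)
    (hsplit : ((Ideal.span {(p : ℤ)}).primesOver (𝓞 K)).ncard = 2) (hodd : Odd (discr K))
    (hne3 : discr K ≠ -3) (hκ : κ.IsAnticyclotomic)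
    (hι : ∀ (w : InfinitePlace K) (k : 𝓞 K), k ∈ v.asIdeal ↔ ‖ι'.symm (w.embedding (k : K))‖ < 1)
    (hvbar : ((p : ℕ) : 𝓞 K) ∈ vbar.asIdeal) (hne : vbar ≠ v) :
    ∃ (ΩK : ℂ) (Ωp : (unrIntegers p)ˣ) (L : UnrSeries p),
      ΩK ≠ 0 ∧ IsBDPLFunction ι' v κ γ f ΩK ((Ωp : unrIntegers p) : ℂ_[p]) L ∧
      ∀ (D : (W.baseChange K).LambdaAdicSelmerData κ γ) (F : HeegnerFamily N W K κ jbar)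
        (X : (W.baseChange K).SelmerDualData κ γ) (j : ℤ_[p] →+* unrIntegers p),
        ¬ (p : ℤ) ∣ F.Dt.c →
        (∀ x : ℤ_[p], ((j x : unrIntegers p) : ℂ_[p]) = algebraMap ℚ_[p] ℂ_[p] (x : ℚ_[p])) →
        heegnerCharIdeal D F ^ 2 ≤
            Module.charIdeal (IwasawaAlgebra p) (Submodule.torsion (IwasawaAlgebra p) X.X) →
          L ∈ (AcSelmer.XAc.charIdeal (W.baseChange K) p κ vbar ∅ γ).map (PowerSeries.map j) := by
  obtain ⟨ΩK, Ωp, L, hΩK, hL, -, himp⟩ :=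
    h ι' W K v vbar κ γ jbar hf hN hp hord hirr hK hH hsplit hodd hne3 hκ hι hvbar hne
  refine ⟨ΩK, Ωp, L, hΩK, hL, fun D F X j hc hj hle ↦ ?_⟩
  have h1 : ∃ n : ℕ, ∀ g ∈ heegnerCharIdeal D F ^ 2,
      (1 : IwasawaAlgebra p) ^ n * g ∈
        Module.charIdeal (IwasawaAlgebra p) (Submodule.torsion (IwasawaAlgebra p) X.X) :=
    ⟨0, fun g hg ↦ by rw [pow_zero, one_mul]; exact hle hg⟩
  obtain ⟨n, hn⟩ := (himp D F X j hc hj 1 one_ne_zero).1 h1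
  rwa [map_one, one_pow, one_mul] at hn

end AnyClassNumberAPI

end Literature.NumberTheory.EllipticCurves.YanZhu2026

end
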